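import Summits.MatrixMultiplication.OmegaCensus.DominoZpZpConsistCheck
import Summits.MatrixMultiplication.OmegaCensus.DominoZpZpScaled
import Summits.MatrixMultiplication.OmegaCensus.DominoLineUnitObstruction
import Summits.MatrixMultiplication.OmegaCensus.DominoLineUnitObstructionPair
import Summits.MatrixMultiplication.OmegaCensus.DominoLineSignCertificate
import HarnessLib

/-!
# Certified key tables for the moment-consistency route: from four certificate kinds to the completeness hypothesis

ω-census `pub-omega`, family (b3), seat pub-omega-group gen 27.  Framing: lottery ticket; floor = certified bounds/negative
ranges.  VALUE: the glue between the per-key certificates already in the tree and the completeness hypothesis `hcomp` of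
`DominoZpZpConsist.no_law_cube_1de_of_onto_zpzp_of_consist` (and its representative hypothesis `hrep`: `repCheck` /
`rep_of_repCheck`); independent of the algebra files; NOT progress on ω.

A TABLE lists, for every line key `F` of size `d` UP TO UNIT SCALING `F ↦ F ∘ (j·)`, one record: a unit certificate `(q, r)`
(`DominoLineUnitObstruction.unitCert`), a pair certificate `(q, c)` (`DominoLineUnitObstructionPair.unitCert2`), a modular Farkas
certificate (`DominoZ5LineTables.lineCert`) — each excluding every shift `s` — or a SIGN record `(rows, bad, goods)`: the shifts in `bad`
are excluded by `DominoLineSignCertificate.signCert` (constant `K`), the shifts in `goods` are ADMITTED, and `bad ∪ goods` covers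
`ZMod p`.  The admitted pairs, expanded by all unit scalings (`expandLst`), form the list `Lst` of the consistency checker.
* `line_identity_scale`: solutions of the normalised line identity are stable under `(F, G, s) ↦ (F∘(J·), G∘(J·), J⁻¹ s)`;
* `recOK` / `lstOfTable` / `expandLst` / `unitPairs` / `scaleKeyInv` / `keyCodes` / `complCheck` (programs);
* `complete_of_checks`: `recOK` on every record + `complCheck` (every composition of `d` into `p` parts has a scaling whose
  base-`(d+1)` code is found in the search tree of the table's codes — soundness via `BTree.mem_build`, `polyBE_inj`) ⇒ `hcomp`
  for `Lst = expandLst p (lstOfTable tab)`.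
-/

namespace Summit.MatrixMultiplication.OmegaCensus

open Finset

namespace ZpZpDomino

/-! ## Scaling a solution of the line identity -/

section Scale

variable {p : ℕ} [Fact p.Prime]

/-- **Scaling**: if `(F, G, s)` solves the normalised line identity and `J·I = 1`, so does `(F∘(J·), G∘(J·), I·s)`. [folklore] -/
theorem line_identity_scale {F G : ZMod p → ℕ} {s : ZMod p} {K : ℕ} (J I : ZMod p) (hJI : J * I = 1)
    (hid : ∀ τ : ZMod p, (∑ v : ZMod p, (F (τ - v) + F (v - τ) + F (τ + v)) * G v) + (if s = τ then 1 else 0) = K)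
    (τ : ZMod p) :
    (∑ v : ZMod p, (F (J * (τ - v)) + F (J * (v - τ)) + F (J * (τ + v))) * G (J * v)) + (if I * s = τ then 1 else 0) = K := by
  have hJ0 : J ≠ 0 := left_ne_zero_of_mul_eq_one hJI
  have h := hid (J * τ)
  rw [← h]
  congr 1
  · refine Fintype.sum_equiv (Equiv.mulLeft₀ J hJ0) _ _ fun v => ?_
    show _ = (F (J * τ - J * v) + F (J * v - J * τ) + F (J * τ + J * v)) * G (J * v)
    rw [mul_sub, mul_sub, mul_add]
  · have e : (I * s = τ) ↔ (s = J * τ) := by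
      constructor
      · intro h1; rw [← h1, ← mul_assoc, hJI, one_mul]
      · intro h1; rw [h1, ← mul_assoc, mul_comm I J, hJI, one_mul]
    simp only [e]

end Scale

/-! ## Records, tables, programs -/

/-- A certificate record for one line key (up to scaling). [folklore] -/
inductive KeyRec where
  /-- unit-test certificate `(q, r)` (`unitCert`): excludes every shift -/
  | unit (q r : ℕ) : KeyRec
  /-- pair certificate `(q, c)` (`unitCert2`): excludes every shift -/
  | pair (q : ℕ) (c : ℤ) : KeyRec
  /-- modular Farkas certificates (`lineCert`): exclude every shift -/
  | farkas (certs : List (ℕ × List ℕ)) : KeyRec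
  /-- sign rows (`signCert`, constant `K`) excluding the shifts in `bad`; the shifts in `goods` are admitted -/
  | sign (rows : List (ℤ × ℕ × List ℤ)) (bad goods : List ℕ) : KeyRec

/-- The admitted shifts of a record. [folklore] -/
def KeyRec.goods : KeyRec → List ℕ
  | .sign _ _ goods => goods
  | _ => []

/-- **Record check** for key `F` (well-formed: length `p`, entries `≤ d`) against constant `K`. [folklore] -/
def recOK (p d K : ℕ) [Fact p.Prime] (F : List ℕ) (r : KeyRec) : Bool :=
  decide (F.length = p) && (F.all fun x => decide (x ≤ d)) &&
    match r with
    | .unit q r => unitCert p (vecFn F) q r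
    | .pair q c => unitCert2 p F q c
    | .farkas certs => lineCert p (vecFn F) certs
    | .sign rows bad goods =>
      signCert p K (vecFn F) rows bad && (List.range p).all fun s => (bad.any fun b => b == s) || goods.any fun g => g == s

/-- The admitted `(F, s)` of a table (representatives). [folklore] -/
def lstOfTable (tab : List (List ℕ × KeyRec)) : List (List ℕ × ℕ) :=
  tab.flatMap fun e => e.2.goods.map fun s => (e.1, s)

/-- The pairs `(j, i)` of residues with `j·i ≡ 1 (mod p)`. [folklore] -/
def unitPairs (p : ℕ) : List (ℕ × ℕ) :=
  (List.range p).flatMap fun j => (List.range p).filterMap fun i => if j * i % p = 1 then some (j, i) else none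

/-- The scaled key `F ∘ (j·)`: entry `w` is `F[j·w mod p]`. [folklore] -/
def scaleKeyInv (p j : ℕ) (F : List ℕ) : List ℕ := (List.range p).map fun w => F.getD (j * w % p) 0

/-- All unit scalings of the admitted pairs: `(F ∘ (j·), i·s)` for `j·i ≡ 1`. [folklore] -/
def expandLst (p : ℕ) (L : List (List ℕ × ℕ)) : List (List ℕ × ℕ) :=
  L.flatMap fun T => (unitPairs p).map fun ji => (scaleKeyInv p ji.1 T.1, ji.2 * T.2 % p)

/-- Base-`(d+1)` codes of the table keys (the table should be sorted by code for the search tree to be effective). [folklore] -/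
def keyCodes (d : ℕ) (tab : List (List ℕ × KeyRec)) : List ℕ := tab.map fun e => polyBE (d + 1) e.1

/-- **Completeness check**: every composition in `Fs` has a unit scaling whose code the search tree finds. [folklore] -/
def complCheck (p d : ℕ) (tree : BTree) (Fs : List (List ℕ)) : Bool :=
  Fs.all fun F => (unitPairs p).any fun ji => tree.mem (polyBE (d + 1) (scaleKeyInv p ji.1 F))

/-! ## The representative check -/

/-- **Representative certificate**: `W` lists, aligned with `Lst`, a unit `k` and an index `j` into `L0` such that `L0[j]` is the
`k`-scaling of the entry: shift `k·s` and key values `L0[j].1[k·v] = F[v]`. [folklore] -/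
def repRow (p : ℕ) (L0 : List (List ℕ × ℕ)) (T : List ℕ × ℕ) (kw : ℕ × ℕ) : Bool :=
  decide (kw.1 % p ≠ 0) && decide (kw.2 < L0.length) && decide ((L0.getD kw.2 ([], 0)).2 % p = kw.1 * T.2 % p) &&
    (List.range p).all fun v => (L0.getD kw.2 ([], 0)).1.getD (kw.1 * v % p) 0 == T.1.getD v 0

/-- The representative check over the aligned lists `Lst`, `W` (one `repRow` each). [folklore] -/
def repCheck (p : ℕ) (Lst L0 : List (List ℕ × ℕ)) (W : List (ℕ × ℕ)) : Bool :=
  decide (Lst.length ≤ W.length) && (List.zipWith (repRow p L0) Lst W).all id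

/-- **Soundness of the representative certificate.** [folklore] -/
theorem rep_of_repCheck {p : ℕ} {Lst L0 : List (List ℕ × ℕ)} {W : List (ℕ × ℕ)} (h : repCheck p Lst L0 W = true) :
    ∀ T ∈ Lst, ∃ k : ℕ, k % p ≠ 0 ∧ ∃ T' ∈ L0, T'.2 % p = k * T.2 % p ∧ ∀ v < p, T'.1.getD (k * v % p) 0 = T.1.getD v 0 := by
  intro T hT
  unfold repCheck at h
  simp only [Bool.and_eq_true, decide_eq_true_eq, List.all_eq_true] at h
  obtain ⟨hlen, hall⟩ := h
  obtain ⟨i, hi, rfl⟩ := List.getElem_of_mem hT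
  have hiW : i < W.length := lt_of_lt_of_le hi hlen
  have hlen2 : i < (List.zipWith (repRow p L0) Lst W).length := by rw [List.length_zipWith]; exact lt_min hi hiW
  have hmem : repRow p L0 Lst[i] W[i] ∈ List.zipWith (repRow p L0) Lst W := by
    rw [List.mem_iff_getElem]; exact ⟨i, hlen2, List.getElem_zipWith⟩
  have hz : repRow p L0 Lst[i] W[i] = true := hall _ hmem
  unfold repRow at hz
  simp only [Bool.and_eq_true, decide_eq_true_eq, List.all_eq_true, List.mem_range, beq_iff_eq] at hz
  obtain ⟨⟨⟨hk, hj⟩, hs⟩, hv⟩ := hz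
  refine ⟨(W[i]).1, hk, L0.getD (W[i]).2 ([], 0), ?_, hs, hv⟩
  rw [List.getD_eq_getElem?_getD, List.getElem?_eq_getElem hj]
  exact List.getElem_mem _

/-! ## Small lemmas -/

/-- Members of `unitPairs`. [folklore] -/
theorem mem_unitPairs {p j i : ℕ} : (j, i) ∈ unitPairs p ↔ j < p ∧ i < p ∧ j * i % p = 1 := by
  unfold unitPairs
  simp only [List.mem_flatMap, List.mem_range, List.mem_filterMap, Option.ite_none_right_eq_some, Option.some.injEq,
    Prod.mk.injEq]
  constructor
  · rintro ⟨j', hj', i', hi', h, rfl, rfl⟩; exact ⟨hj', hi', h⟩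
  · rintro ⟨hj, hi, h⟩; exact ⟨j, hj, i, hi, h, rfl, rfl⟩

/-- Length of `scaleKeyInv`. [folklore] -/
theorem length_scaleKeyInv (p j : ℕ) (F : List ℕ) : (scaleKeyInv p j F).length = p := by simp [scaleKeyInv]

/-- Entries of `scaleKeyInv`. [folklore] -/
theorem getD_scaleKeyInv {p j : ℕ} (F : List ℕ) {w : ℕ} (hw : w < p) :
    (scaleKeyInv p j F).getD w 0 = F.getD (j * w % p) 0 := by
  unfold scaleKeyInv; rw [getD_map_range _ hw]

/-- A list of length `p` is the map of its entries over `range p`. [folklore] -/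
theorem eq_map_getD_range (F : List ℕ) : F = (List.range F.length).map fun w => F.getD w 0 := by
  refine List.ext_getElem (by simp) fun i h1 h2 => ?_
  simp [List.getD_eq_getElem?_getD, List.getElem?_eq_getElem h1]

/-- Scaling by `i` undoes scaling by `j` when `j·i ≡ 1`. [folklore] -/
theorem scaleKeyInv_scaleKeyInv {p j i : ℕ} (hp : 0 < p) (hji : j * i % p = 1) {F : List ℕ} (hF : F.length = p) :
    scaleKeyInv p i (scaleKeyInv p j F) = F := by
  conv_rhs => rw [eq_map_getD_range F, hF]
  unfold scaleKeyInv
  refine List.map_congr_left fun w hw => ?_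
  rw [List.mem_range] at hw
  rw [getD_map_range _ (Nat.mod_lt _ hp)]
  congr 1
  rw [Nat.mul_mod, Nat.mod_mod, ← Nat.mul_mod, ← mul_assoc, Nat.mul_mod, hji, one_mul, Nat.mod_mod, Nat.mod_eq_of_lt hw]

/-- The entries of the admitted list. [folklore] -/
theorem mem_lstOfTable {tab : List (List ℕ × KeyRec)} {e : List ℕ × KeyRec} (he : e ∈ tab) {s : ℕ} (hs : s ∈ e.2.goods) :
    (e.1, s) ∈ lstOfTable tab := by
  unfold lstOfTable
  exact List.mem_flatMap.2 ⟨e, he, List.mem_map.2 ⟨s, hs, rfl⟩⟩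

/-! ## From the checks to the completeness hypothesis -/

section Complete

variable {p : ℕ} [Fact p.Prime]

/-- `vecFn` of a scaled key is the scaled function. [folklore] -/
theorem vecFn_scaleKeyInv (j : ℕ) (F : List ℕ) (w : ZMod p) :
    vecFn (scaleKeyInv p j F) w = vecFn F (((j : ℕ) : ZMod p) * w) := by
  haveI : NeZero p := ⟨(Fact.out : p.Prime).ne_zero⟩
  show (scaleKeyInv p j F).getD w.val 0 = F.getD (((j : ℕ) : ZMod p) * w).val 0
  rw [getD_scaleKeyInv F (ZMod.val_lt w), ZMod.val_mul, ZMod.val_natCast, Nat.mod_mul_mod]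

/-- **Completeness from the checks.**  If every record passes `recOK` and every composition of `d` into `p` parts has a scaling
found in the table's search tree, then every key with a solution of the line identity (constant `K`) is listed, with its shift,
in `expandLst p (lstOfTable tab)`. [folklore] -/
theorem complete_of_checks (hp5 : 5 ≤ p) {d K : ℕ} {tab : List (List ℕ × KeyRec)}
    (hrec : ∀ e ∈ tab, recOK p d K e.1 e.2 = true) {fuel n : ℕ}
    (hcompl : complCheck p d (BTree.build fuel n (keyCodes d tab)) (compsLB [] p d) = true) :
    ∀ F ∈ compsLB [] p d, ∀ (G : ZMod p → ℕ) (s : ZMod p),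
      (∀ τ : ZMod p, (∑ v : ZMod p, (vecFn F (τ - v) + vecFn F (v - τ) + vecFn F (τ + v)) * G v) +
        (if s = τ then 1 else 0) = K) → (F, s.val) ∈ expandLst p (lstOfTable tab) := by
  classical
  haveI : NeZero p := ⟨(Fact.out : p.Prime).ne_zero⟩
  have hp : 0 < p := (Fact.out : p.Prime).pos
  have hp1 : 1 < p := (Fact.out : p.Prime).one_lt
  intro F hF G s hid
  obtain ⟨hlen, hsum⟩ := of_mem_compsLB [] p d F hF
  -- a scaling found in the table
  unfold complCheck at hcompl
  rw [List.all_eq_true] at hcompl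
  have h1 := hcompl F hF
  rw [List.any_eq_true] at h1
  obtain ⟨⟨j, i⟩, hji, hmem⟩ := h1
  obtain ⟨hj, hi, hji1⟩ := mem_unitPairs.1 hji
  have hcode := BTree.mem_build hmem
  unfold keyCodes at hcode
  obtain ⟨e, he, hecode⟩ := List.mem_map.1 hcode
  set Fj := scaleKeyInv p j F with hFj
  -- the record is well formed and certified
  have hre := hrec e he
  unfold recOK at hre
  simp only [Bool.and_eq_true, decide_eq_true_eq, List.all_eq_true] at hre
  obtain ⟨⟨helen, hele⟩, hcert⟩ := hre
  -- `e.1 = Fj` by injectivity of the code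
  have hFjlt : ∀ x ∈ Fj, x < d + 1 := by
    intro x hx
    rw [hFj, scaleKeyInv, List.mem_map] at hx
    obtain ⟨w, -, rfl⟩ := hx
    have := getD_le_sum F (j * w % p)
    omega
  have heq : e.1 = Fj :=
    polyBE_inj (by rw [helen, hFj, length_scaleKeyInv]) (fun x hx => Nat.lt_succ_of_le (hele x hx)) hFjlt hecode
  -- the scaled solution
  set J : ZMod p := ((j : ℕ) : ZMod p) with hJ
  set I : ZMod p := ((i : ℕ) : ZMod p) with hI
  have hJI : J * I = 1 := by
    have e1 := (ZMod.natCast_eq_natCast_iff' (j * i) 1 p).2 (by rw [hji1, Nat.mod_eq_of_lt hp1])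
    push_cast at e1
    exact e1
  have hid' : ∀ τ : ZMod p, (∑ v : ZMod p, (vecFn Fj (τ - v) + vecFn Fj (v - τ) + vecFn Fj (τ + v)) * G (J * v)) +
      (if I * s = τ then 1 else 0) = K := by
    intro τ
    have h := line_identity_scale J I hJI hid τ
    simp only [hFj, vecFn_scaleKeyInv]
    exact h
  -- case analysis on the record
  revert hcert
  rcases e with ⟨key, rec⟩
  simp only at heq helen hele
  subst heq
  intro hcert
  cases rec with
  | unit q r => exact (unitCert_sound hp5 hcert _ _ K hid').elim
  | pair q c => exact (unitCert2_sound hp5 hcert _ _ K hid').elim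
  | farkas certs => exact (lineCert_sound hcert _ _ K hid').elim
  | sign rows bad goods =>
    rw [Bool.and_eq_true] at hcert
    obtain ⟨hsign, hcov⟩ := hcert
    by_cases hbad : (I * s).val ∈ bad
    · exact (signCert_sound hsign _ _ hbad hid').elim
    · -- the shift is admitted
      rw [List.all_eq_true] at hcov
      have h2 := hcov (I * s).val (List.mem_range.2 (ZMod.val_lt _))
      rw [Bool.or_eq_true, List.any_eq_true, List.any_eq_true] at h2
      have hgood : (I * s).val ∈ goods := by
        rcases h2 with ⟨b, hb, hbe⟩ | ⟨g, hg, hge⟩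
        · exact absurd (by rw [beq_iff_eq] at hbe; rw [← hbe]; exact hb) hbad
        · rw [beq_iff_eq] at hge; rw [← hge]; exact hg
      have hT : (scaleKeyInv p j F, (I * s).val) ∈ lstOfTable tab := mem_lstOfTable he hgood
      unfold expandLst
      refine List.mem_flatMap.2 ⟨_, hT, List.mem_map.2 ⟨(i, j), mem_unitPairs.2 ⟨hi, hj, by rwa [mul_comm]⟩, ?_⟩⟩
      simp only
      rw [scaleKeyInv_scaleKeyInv hp hji1 hlen]
      congr 1
      have e3 : (((j * (I * s).val : ℕ)) : ZMod p) = s := by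
        push_cast
        rw [ZMod.natCast_zmod_val, ← hJ, ← mul_assoc, hJI, one_mul]
      rw [← ZMod.val_natCast, e3]

end Complete

end ZpZpDomino

end Summit.MatrixMultiplication.OmegaCensus
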